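import Summits.PneNP.PneNP.Theorems.LatticeMagicTargetStubBridgeCode
import Literature.Computability.Complexity.CodeFPListKit
import Literature.Computability.MetaComplexity.ProofSystemsTautProofs

/-!
# `stub_bridge`, part 4/6: the generator on codes and the bridge verifier

Line `SketchIdeator5` of crux `Target` (stmt-PneNP-10709), stub `stub_bridge` (Krajíček,
arXiv:2506.20221 §2: a strong proof system "EF + a polynomial-time set of tautologies"; here the set
is tailored to `g`). Contents:

* the rest of the generator on codes: the capped enumeration `codeFP_vecsFold`, the guard
  (`2^{#images}` in binary against the unary pad, `codeFP_guard`), the tree's `bigDisj` on codes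
  (`rawReverse`, `disjFold`, `codeFP_bigDisj`), **`codeFP_disjuncts`**, **`codeFP_genForm`**;
* the normaliser `paramNormF` (every string becomes a parameter code `⟨N, ⟨encList w⃗, 1ᵐ⟩⟩`, parameter
  codes are fixed), so that the generator is total and sound on all strings;
* **the bridge verifier** `bridgeV V₀ F`: a proof is `0 c` with `c` a `V₀`-proof or `1 r` claiming the
  statement is `F r`; it is polynomial time (`bridgeVFn`, `isPolyTimeVerifier_bridgeV`) and a
  Cook–Reckhow proof system for `TAUT` whenever `V₀` is one and `F ∈ FP` generates only codes of
  tautologies (`isProofSystemFor_bridgeV`).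

## References

* J. Krajíček, *A proof complexity conjecture and the Incompleteness theorem*, arXiv:2506.20221, §2
  (`DD_P`, Hypothesis (ST)); J. Krajíček, LMCS 16 (3:9) 2020.
* S. Arora, B. Barak, *Computational Complexity: A Modern Approach*, CUP 2009, §0.1 (codes), §1.3
  (closure of polynomial time), §2.3 (CNFs, Cook–Levin), Example 2.21.
* S. A. Cook, R. A. Reckhow, JSL 44 (1979), §1 (proof systems).
-/

set_option linter.dupNamespace false -- summit = sub-problem (D-0017)

namespace Summit.PneNP.PneNP.Theorems.LatticeMagicTarget

open Literature.Computability.Complexity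
open Literature.Computability.MetaComplexity
open _root_.Computability

namespace StubBridge

section Code

open CodeFP Brick Plumb Polynomial

variable {Φ : List Bool → CNF ℕ} {gen : List Bool → List Bool}

/-! #### The capped enumeration of vectors -/

/-- Length of a raw list code is at most `#items · (2 L + 2)` when items are at most `L` long. -/
theorem length_rawE_strE_le {l : List (List Bool)} {L : ℕ} (h : ∀ v ∈ l, v.length ≤ L) :
    (rawE strE l).length ≤ l.length * (2 * L + 2) := by
  rw [length_rawE]
  calc (l.map fun a => 2 * (strE a).length + 2).sum ≤ l.length • (2 * L + 2) := by
        refine (List.sum_le_card_nsmul _ _ fun x hx => ?_).trans (by rw [List.length_map])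
        obtain ⟨v, hv, rfl⟩ := List.mem_map.1 hx
        have := h v hv
        change 2 * v.length + 2 ≤ 2 * L + 2
        omega
    _ = l.length * (2 * L + 2) := smul_eq_mul _ _

/-- **The capped doubling fold on codes.** -/
theorem codeFP_vecsFold : CodeFP (pairE unE (rawE strE)) (rawE strE) fun p => vecsFold p.1 p.2 := by
  have hdbl : CodeFP (rawE strE) (rawE strE) fun acc => acc.map (List.cons false) ++ acc.map (List.cons true) :=
    (rawAppend strE).comp ((map₀ (codeFP_cons false)).pair (map₀ (codeFP_cons true)))
  have hstep : CodeFP (pairE unE (pairE strE (rawE strE))) (rawE strE) fun t => vecsStep t.1 t.2.2 := by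
    refine ((unLeNat.comp (((ulength strE).comp (snd _ _).snd').pair (natOfUn.comp (fst _ _)))).ite
      (hdbl.comp (snd _ _).snd') (snd _ _).snd').congr fun t => ?_
    simp only [vecsStep, id]
    by_cases h : t.2.2.length ≤ t.1 <;> simp [h]
  have h := foldl (step := fun m (_ : List Bool) acc => vecsStep m acc) (init := fun _ => [([] : List Bool)]) hstep
    (const unE [([] : List Bool)]) ((2 * X + 1) * (2 * X + 2)) (fun m l₁ l₂ => by
      set W := pairE unE (rawE strE) (m, l₁ ++ l₂) with hW
      have hWlen : W.length = 2 * m + 2 + (rawE strE (l₁ ++ l₂)).length := by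
        rw [hW, pairE_apply, length_boolPair, length_unE]
      have hcnt := length_foldl_vecsStep_le m l₁ [[]] (by simp)
      have hlen := length_le_of_mem_foldl_vecsStep m l₁ [[]] 0 (by simp)
      simp only [Nat.zero_add] at hlen
      have hl₁ : l₁.length ≤ W.length :=
        (List.Sublist.length_le (List.sublist_append_left l₁ l₂)).trans
          ((length_le_length_rawE strE _).trans (by omega))
      refine (length_rawE_strE_le hlen).trans ?_
      simp only [eval_mul, eval_add, eval_X, eval_ofNat]
      exact Nat.mul_le_mul (by omega) (by omega))
  exact h.congr fun p => rfl

/-! #### The guard -/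

/-- `2^{#items}` in binary. -/
theorem codeFP_pow2 : CodeFP (rawE strE) natE fun ws => 2 ^ ws.length :=
  (natPow.comp ((const (rawE strE) 2).pair (ulength strE))).congr fun _ => rfl

/-- **The guard on codes.** -/
theorem codeFP_guard : CodeFP paramE bitE guard :=
  (natLeUn.comp ((codeFP_pow2.comp (snd _ _).fst').pair (unSucc.comp (snd _ _).snd'))).congr fun a => by
    simp [guard]

/-! #### The disjunction on codes -/

/-- Growth of one disjunction on codes. -/
theorem length_encE_disj (φ ψ : PropForm ℕ) :
    (encE (PropForm.disj φ ψ)).length = (encE φ).length + (encE ψ).length + 3 := by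
  simp only [length_encE, PropForm.size, PropForm.code, List.length_cons, List.length_append]
  omega

/-- Size of `disjFold` on codes. -/
theorem length_encE_disjFold_le (P : ℕ) : ∀ (r : List (PropForm ℕ)) (a : PropForm ℕ),
    (∀ φ ∈ r, (encE φ).length ≤ P) → (encE (disjFold a r)).length ≤ (encE a).length + r.length * (P + 3)
  | [], a, _ => by simp [disjFold]
  | φ :: r, a, h => by
    rw [disjFold, List.foldl_cons, ← disjFold]
    refine (length_encE_disjFold_le P r _ fun ψ hψ => h ψ (by simp [hψ])).trans ?_
    rw [length_encE_disj, List.length_cons, Nat.succ_mul]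
    have := h φ (by simp)
    omega

/-- `disjFold` on codes. -/
theorem codeFP_disjFold : CodeFP (pairE encE (rawE encE)) encE fun p => disjFold p.1 p.2 := by
  have hstep : CodeFP (pairE encE (pairE encE encE)) encE fun t => PropForm.disj t.2.1 t.2.2 :=
    codeFP_disj.comp (snd _ _)
  have h := foldl (step := fun (_ : PropForm ℕ) φ acc => PropForm.disj φ acc) (init := fun a => a) hstep
    (CodeFP.id encE) (X + X * (X + 3)) (fun a l₁ l₂ => by
      set W := pairE encE (rawE encE) (a, l₁ ++ l₂) with hW
      have hWlen : W.length = 2 * (encE a).length + 2 + (rawE encE (l₁ ++ l₂)).length := by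
        rw [hW, pairE_apply, length_boolPair]
      have hitem : ∀ φ ∈ l₁, (encE φ).length ≤ W.length := fun φ hφ => by
        have := length_item_le_length_rawE encE (List.mem_append_left l₂ hφ)
        omega
      have hl₁ : l₁.length ≤ W.length :=
        (List.Sublist.length_le (List.sublist_append_left l₁ l₂)).trans
          ((length_le_length_rawE encE _).trans (by omega))
      have h1 := length_encE_disjFold_le W.length l₁ a hitem
      rw [show l₁.foldl (fun b φ => PropForm.disj φ b) a = disjFold a l₁ from rfl]
      simp only [eval_add, eval_mul, eval_X, eval_ofNat]
      have hmul : l₁.length * (W.length + 3) ≤ W.length * (W.length + 3) := Nat.mul_le_mul_right _ hl₁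
      omega)
  exact h.congr fun p => rfl

/-- `bigDisj` of a reversed nonempty list / of the empty list. -/
def bigDisjRev : List (PropForm ℕ) → PropForm ℕ
  | [] => PropForm.const false
  | a :: r => disjFold a r

/-- `bigDisj l` through the reversed list. -/
theorem bigDisjRev_reverse (l : List (PropForm ℕ)) : bigDisjRev l.reverse = bigDisj l := by
  rcases h : l.reverse with _ | ⟨a, r⟩
  · rw [List.reverse_eq_nil_iff.1 h]; rfl
  · rw [bigDisjRev, ← bigDisj_reverse_cons, ← h, List.reverse_reverse]

/-- **The tree's `bigDisj` on codes.** -/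
theorem codeFP_bigDisj : CodeFP (rawE encE) encE bigDisj := by
  have hc := rawCases (σ := Unit) (eσ := fun _ => []) (eα := encE) (k := fun _ r => bigDisjRev r)
    (gnil := fun _ => PropForm.const false) (gcons := fun t => disjFold t.2.1 t.2.2)
    (const _ _) (codeFP_disjFold.comp (snd _ _)) (fun _ => rfl) (fun _ _ _ => rfl)
  exact ((hc.comp ((const (rawE encE) ()).pair (rawReverse encE))).congr fun l => bigDisjRev_reverse l)

/-! #### The generator -/

/-- **The list of disjuncts on codes.** -/
theorem codeFP_disjuncts (hgen : gen ∈ FP) (hgenΦ : ∀ x, gen x = encodingCNF.encode (Φ x)) :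
    CodeFP paramE (rawE encE) (disjuncts Φ) := by
  have hv : CodeFP paramE (rawE strE) fun a => vecsFold a.2.2 a.2.1 :=
    codeFP_vecsFold.comp ((snd _ _).snd'.pair (snd _ _).fst')
  exact ((map (codeFP_disjunct hgen hgenΦ)).comp (((fst _ _).pair (snd _ _).fst').pair hv)).congr fun a => rfl

/-- **The generated formula on codes.** -/
theorem codeFP_genForm (hgen : gen ∈ FP) (hgenΦ : ∀ x, gen x = encodingCNF.encode (Φ x)) :
    CodeFP paramE encE (genForm Φ) :=
  (codeFP_guard.ite (codeFP_bigDisj.comp (codeFP_disjuncts hgen hgenΦ))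
    (const paramE (PropForm.const true))).congr fun a => by simp only [genForm]

end Code

/-! ## Part 4: the proof system `V = V₀ ⊕ {regenerated game tautologies}` -/

section ProofSystem

open Brick Plumb CodeFP

/-! #### Normalising an arbitrary string into a parameter code -/

/-- Fold step rebuilding a coded list: append the item's pair code. -/
noncomputable def relistStep : List Bool → List Bool :=
  fun v => (sndF ∘ sndF) v ++ fanoutFn (fstF ∘ sndF) (fun _ => []) v

/-- `relistStep ∈ FP`. -/
theorem relistStep_mem_FP : relistStep ∈ FP := by
  unfold relistStep
  exact append_mem_FP (comp_mem_FP sndF_mem_FP sndF_mem_FP)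
    (fanoutFn_mem_FP (comp_mem_FP fstF_mem_FP sndF_mem_FP) (const_mem_FP _))

/-- Value of `relistStep`. -/
theorem relistStep_apply (v : List Bool) : relistStep v = sndF (sndF v) ++ boolPair (fstF (sndF v)) [] := by
  simp [relistStep]

/-- Re-encode the total decoding of a string as a genuine coded list: `L ↦ encList (decNil L)`. -/
noncomputable def relistF : List Bool → List Bool := foldFn relistStep (fun _ => []) ∘ fanoutFn (fun _ => []) id

/-- `relistF ∈ FP`. -/
theorem relistF_mem_FP : relistF ∈ FP :=
  comp_mem_FP (foldFn_mem_FP relistStep_mem_FP (const_mem_FP _) (c := 2) fun v => by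
    simp only [relistStep_apply, List.length_append, length_boolPair, List.length_nil]; omega)
    (fanoutFn_mem_FP (const_mem_FP _) (PolyTimeComputable.id _))

/-- **`relistF L = encList (decNil L)`.** -/
theorem relistF_apply (L : List Bool) : relistF L = encList (decNil L) := by
  simp only [relistF, Function.comp_apply, fanoutFn_apply, id, foldFn_boolPair]
  suffices h : ∀ (l : List (List Bool)) (acc : List (List Bool)),
      l.foldl (fun acc a => relistStep (boolPair (boolPair [] L) (boolPair a acc))) (encList acc) = encList (acc ++ l) by
    simpa using h (decNil L) []
  intro l
  induction l with
  | nil => intro acc; simp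
  | cons a l ih =>
    intro acc
    have happ : encList (acc ++ [a]) = encList acc ++ boolPair a [] := by
      have := rawE_append strE acc [a]
      simpa [rawE, strE, encList] using this
    rw [List.foldl_cons, show relistStep (boolPair (boolPair [] L) (boolPair a (encList acc))) = encList (acc ++ [a]) by
      simp [relistStep_apply, happ], ih]
    simp

/-- The normaliser: `z ↦ ⟨fstF z, ⟨encList (decNil (nthF 1 z)), 1^{|sndPow 1 z|}⟩⟩`. -/
noncomputable def paramNormF : List Bool → List Bool :=
  fanoutFn fstF (fanoutFn (relistF ∘ nthF 1) (onesFn ∘ sndPow 1))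

/-- `paramNormF ∈ FP`. -/
theorem paramNormF_mem_FP : paramNormF ∈ FP :=
  fanoutFn_mem_FP fstF_mem_FP (fanoutFn_mem_FP (comp_mem_FP relistF_mem_FP (nthF_mem_FP 1))
    (comp_mem_FP onesFn_mem_FP (sndPow_mem_FP 1)))

/-- The parameter read off an arbitrary string. -/
def parseParam (z : List Bool) : Param := (fstF z, decNil (nthF 1 z), (sndPow 1 z).length)

/-- **Every string normalises to a parameter code.** -/
theorem paramNormF_eq_paramE (z : List Bool) : paramNormF z = paramE (parseParam z) := by
  simp only [paramNormF, fanoutFn_apply, Function.comp_apply, relistF_apply, parseParam, pairE_apply, rawE,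
    strE, List.map_id, unE, onesFn]
  rfl

/-- **Parameter codes are fixed by the normaliser.** -/
theorem paramNormF_paramE (a : Param) : paramNormF (paramE a) = paramE a := by
  obtain ⟨N, ws, m⟩ := a
  simp only [paramNormF, fanoutFn_apply, Function.comp_apply, pairE_apply, fstF_boolPair, nthF_succ_boolPair, nthF_zero,
    sndPow_succ_boolPair, sndPow_zero, sndF_boolPair, relistF_apply, rawE, strE, List.map_id, decNil_encList, onesFn,
    length_unE]

/-! #### The verifier -/

/-- **The bridge verifier**: a proof is either `0 c` with `c` a `V₀`-proof, or `1 r` claiming that the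
statement is the regenerated formula `F r`. -/
def bridgeV (V₀ : List Bool → List Bool → Bool) (F : List Bool → List Bool) (x : List Bool) : List Bool → Bool
  | [] => false
  | false :: c => V₀ x c
  | true :: r => decide (x = F r)

/-- The head-bit test `[π.headD false]`. -/
noncomputable def piHeadF : List Bool → List Bool :=
  eqPairFn ∘ fanoutFn (takeFn ∘ fanoutFn (fun _ => [true]) id) (fun _ => [true])

/-- Value of `piHeadF`. -/
theorem piHeadF_apply (s : List Bool) : piHeadF s = [s.headD false] := by
  cases s with
  | nil => simp [piHeadF, eqPairFn_boolPair]
  | cons b s => cases b <;> simp [piHeadF, eqPairFn_boolPair]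

/-- `piHeadF ∈ FP`. -/
theorem piHeadF_mem_FP : piHeadF ∈ FP :=
  comp_mem_FP eqPairFn_mem_FP (fanoutFn_mem_FP (comp_mem_FP takeFn_mem_FP
    (fanoutFn_mem_FP (const_mem_FP _) (PolyTimeComputable.id _))) (const_mem_FP _))

/-- The tail `π ⇂ 1`. -/
noncomputable def piTailF : List Bool → List Bool := dropFn ∘ fanoutFn (fun _ => [true]) id

/-- Value of `piTailF`. -/
theorem piTailF_apply (s : List Bool) : piTailF s = s.drop 1 := by simp [piTailF]

/-- `piTailF ∈ FP`. -/
theorem piTailF_mem_FP : piTailF ∈ FP :=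
  comp_mem_FP dropFn_mem_FP (fanoutFn_mem_FP (const_mem_FP _) (PolyTimeComputable.id _))

/-- The bridge verifier as a one-bit string function on `⟨x, π⟩`. -/
noncomputable def bridgeVFn (V₀ : List Bool → List Bool → Bool) (F : List Bool → List Bool) : List Bool → List Bool :=
  iteFn (isNilFn ∘ sndF) (fun _ => [false])
    (iteFn (piHeadF ∘ sndF) (eqPairFn ∘ fanoutFn fstF (F ∘ piTailF ∘ sndF))
      ((fun z => [V₀ (boolUnpair z).1 (boolUnpair z).2]) ∘ fanoutFn fstF (piTailF ∘ sndF)))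

/-- `bridgeVFn ∈ FP` for a polynomial-time `V₀` and `F ∈ FP`. -/
theorem bridgeVFn_mem_FP {V₀ : List Bool → List Bool → Bool} (hV₀ : IsPolyTimeVerifier V₀) {F : List Bool → List Bool}
    (hF : F ∈ FP) : bridgeVFn V₀ F ∈ FP := by
  unfold bridgeVFn
  exact iteFn_mem_FP (comp_mem_FP isNilFn_mem_FP sndF_mem_FP) (const_mem_FP _)
    (iteFn_mem_FP (comp_mem_FP piHeadF_mem_FP sndF_mem_FP)
      (comp_mem_FP eqPairFn_mem_FP (fanoutFn_mem_FP fstF_mem_FP (comp_mem_FP hF (comp_mem_FP piTailF_mem_FP sndF_mem_FP))))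
      (comp_mem_FP (verifierFn_mem_FP hV₀) (fanoutFn_mem_FP fstF_mem_FP (comp_mem_FP piTailF_mem_FP sndF_mem_FP))))

/-- **Value of `bridgeVFn` on a pair.** -/
theorem bridgeVFn_boolPair (V₀ : List Bool → List Bool → Bool) (F : List Bool → List Bool) (x π : List Bool) :
    bridgeVFn V₀ F (boolPair x π) = [bridgeV V₀ F x π] := by
  unfold bridgeVFn
  cases π with
  | nil =>
    rw [iteFn_apply_true (by simp [isNilFn])]
    rfl
  | cons b π =>
    rw [iteFn_apply_false (by simp [isNilFn])]
    cases b with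
    | true =>
      rw [iteFn_apply_true (by simp [piHeadF_apply])]
      simp [piTailF_apply, eqPairFn_boolPair, bridgeV]
    | false =>
      rw [iteFn_apply_false (by simp [piHeadF_apply])]
      simp [piTailF_apply, bridgeV]

/-- **The bridge verifier is polynomial time.** -/
theorem isPolyTimeVerifier_bridgeV {V₀ : List Bool → List Bool → Bool} (hV₀ : IsPolyTimeVerifier V₀)
    {F : List Bool → List Bool} (hF : F ∈ FP) : IsPolyTimeVerifier (bridgeV V₀ F) := by
  refine (bridgeVFn_mem_FP hV₀ hF).of_encode (fun p : List Bool × List Bool => boolPair p.1 p.2)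
    (fun _ => rfl) fun p => ?_
  obtain ⟨x, π⟩ := p
  simp only [id, bridgeVFn_boolPair]
  rfl

/-- **The bridge verifier is a Cook–Reckhow proof system for `TAUT`** as soon as `V₀` is one and `F`
(polynomial time) only generates codes of tautologies: completeness through the `V₀`-branch,
soundness of the new branch by the hypothesis on `F`. -/
theorem isProofSystemFor_bridgeV {V₀ : List Bool → List Bool → Bool} (hV₀ : IsProofSystemFor V₀ TAUT)
    {F : List Bool → List Bool} (hF : F ∈ FP) (hFtaut : ∀ r, F r ∈ TAUT) : IsProofSystemFor (bridgeV V₀ F) TAUT := by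
  refine ⟨isPolyTimeVerifier_bridgeV hV₀.1 hF, fun x => ⟨fun hx => ?_, ?_⟩⟩
  · obtain ⟨c, hc⟩ := (hV₀.2 x).1 hx
    exact ⟨false :: c, hc⟩
  · rintro ⟨π, hπ⟩
    match π, hπ with
    | [], hπ => exact absurd hπ (by simp [bridgeV])
    | false :: c, hπ => exact (hV₀.2 x).2 ⟨c, hπ⟩
    | true :: r, hπ =>
      have : x = F r := by simpa [bridgeV] using hπ
      rw [this]; exact hFtaut r

end ProofSystem

end StubBridge

/-- **The bridge verifier is a proof system for `TAUT`** (explicit-binder form, registered sub-goal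
`stubBridge_isProofSystemFor_bridgeV` of stmt-PneNP-10709; chain `stub_bridge` 4/6). -/
theorem stubBridge_isProofSystemFor_bridgeV (V₀ : List Bool → List Bool → Bool) (hV₀ : IsProofSystemFor V₀ TAUT)
    (F : List Bool → List Bool) (hF : F ∈ FP) (hFtaut : ∀ r, F r ∈ TAUT) :
    IsProofSystemFor (StubBridge.bridgeV V₀ F) TAUT :=
  StubBridge.isProofSystemFor_bridgeV hV₀ hF hFtaut

end Summit.PneNP.PneNP.Theorems.LatticeMagicTarget
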